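import Summits.BirchSwinnertonDyer.Rank1Residual.GaloisImage.CongruenceVisibilityTwistedWitness
import HarnessLib

/-!
# Criterion (d) for CLASSES: twisted divisibility of the trivialising point, and a relative-index
# bound from collisions (cell `b2b-bsdres`, team n1011, seat p10 GEN 9; ROW T-VIS3-UC-IOTA
# FILE 1a; skeleton `cells/n1011/skel/T-VIS3-UC-IOTA.md`)

HONEST FRAMING (cell `b2b-bsdres`, run/shared/lean/b2b/bsd-rank1-residual/, verbatim in every
file): the goal of the cell is to DELETE the COMBINATION-SHAPED residual classes of the
Birch–Swinnerton-Dyer formula for ALL analytic-rank `≤ 1` elliptic curves over `ℚ` — "full BSD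
formula for every rank `≤ 1` curve in class `C`" assembled STRICTLY from published theorems — so
that the rank-`≤ 1` remainder becomes exactly the CONSTRUCTION-SHAPED classes, which are TYPED
(missing-input `Prop`s), NOT attempted. This is not "finishing BSD". Team n1011 (N10 / N11):
research route on the CONSTRUCTION-SHAPED class X4 (§I N11 LOWER half / O7); no claim beyond the
stated classes; nothing is booked; marks UNCHANGED. Theorems only: no definition, no named fact,
no `sorry`. TOOL theorems; they close nothing by themselves.

## What

Two generic TOOLS (any field / any group) for THEOREM B in the comparison-index currency (FILE 1b
`CongruenceVisibilityIdentityComponentIndex`):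
* §1 `relIndex_le_of_forall_exists_sub_mem` — `H.relIndex K ≤ n` as soon as among any `n + 1`
  elements of `K` two differ by an element of `H` (pigeonhole in `K ⧸ (H ⊓ K)`);
* §2 `h1Equiv_oneCocycleClass_mem_selmerLocalKer_of_twistedCocycle` — criterion (d) of FILE 1 of
  T-VIS3-UC (`CongruenceVisibilityTwistedWitness.h1Equiv_kummerMapTorsion_mem_selmerLocalKer_of_twistedDivisible`,
  stated there for the Kummer class of a global point) for an ARBITRARY class `[φ] ∈ 𝓢_E(E')`
  trivialised by `a' ∈ E'(K̄_E)`: if `n • a' = n • Q'` with `Q'` fixed by `H` and the `E`-side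
  datum `Q₁` is given, then `θ_*[φ] ∈ 𝓢_E(E)`. Same cocycle computation as FILE 1 §3.
References: [CremonaMazur2000] §3; [MazurRubin2004] §2.3; Silverman *AEC* VIII.§2, X.§4;
L41-NOTE §§1–3 (`HOME/b2b-bsdres-n1011-p10/g8/`). -/

noncomputable section

open scoped Classical

namespace Summit.BirchSwinnertonDyer.Rank1Residual.GaloisImage.TwistedWitness

open WeierstrassCurve Literature.NumberTheory.EllipticCurves Literature.NumberTheory.GaloisRepresentations
open Field NumberField IsDedekindDomain IsDedekindDomain.HeightOneSpectrum

/-! ## §1 A relative index bound from collisions -/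

section Pigeonhole

/-- **`[K : H ⊓ K] ≤ n` from collisions.** If among any `n + 1` elements of `K` two differ by an
element of `H`, then `H.relIndex K ≤ n` (pigeonhole on the cosets of `H ⊓ K` in `K`; an infinite
relative index is `0` by convention, also `≤ n`). [folklore] -/
theorem relIndex_le_of_forall_exists_sub_mem {G : Type*} [AddCommGroup G] (H K : AddSubgroup G)
    (n : ℕ) (h : ∀ f : Fin (n + 1) → G, (∀ i, f i ∈ K) →
      ∃ i j : Fin (n + 1), i ≠ j ∧ f i - f j ∈ H) :
    H.relIndex K ≤ n := by
  rw [AddSubgroup.relIndex]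
  by_cases hfin : (H.addSubgroupOf K).index = 0
  · rw [hfin]; exact Nat.zero_le _
  haveI : (H.addSubgroupOf K).FiniteIndex := ⟨hfin⟩
  haveI : Finite (K ⧸ H.addSubgroupOf K) := AddSubgroup.finite_quotient_of_finiteIndex
  letI : Fintype (K ⧸ H.addSubgroupOf K) := Fintype.ofFinite _
  rw [AddSubgroup.index_eq_card, Nat.card_eq_fintype_card]
  by_contra! hlt
  have hcard : Fintype.card (Fin (n + 1)) ≤ Fintype.card (K ⧸ H.addSubgroupOf K) := by
    rw [Fintype.card_fin]; omega
  obtain ⟨e⟩ := Function.Embedding.nonempty_of_card_le hcard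
  obtain ⟨i, j, hij, hmem⟩ :=
    h (fun i ↦ ((Quotient.out (e i) : K) : G)) (fun i ↦ (Quotient.out (e i)).2)
  refine hij (e.injective ?_)
  rw [← QuotientAddGroup.out_eq' (e i), ← QuotientAddGroup.out_eq' (e j),
    QuotientAddGroup.eq_iff_sub_mem, AddSubgroup.mem_addSubgroupOf, AddSubgroup.coe_sub]
  exact hmem

end Pigeonhole

/-! ## §2 Criterion (d) at the level of classes -/

section Criterion

variable {K : Type} [Field K] [CharZero K] (W W' : WeierstrassCurve K) [W'.IsElliptic]
  {n : ℤ} (θ : geomTorsion W' n ≃+ geomTorsion W n)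
  (hθ : ∀ (σ : absoluteGaloisGroup K) (P : geomTorsion W' n), θ (σ • P) = σ • θ P)
  (E : Type) [Field E] [Algebra K E]

/-- **Criterion (d) for classes — twisted divisibility of the trivialising point.** `K` of
characteristic `0`, `n ≠ 0`, `θ : E'[n] ⥲ E[n]` a `Γ_K`-isomorphism, `E` a `K`-field with
`Γ = Γ_E`, `H ⊴ Γ`, every `σ = F ^ i * h` (`h ∈ H`), `H`-fixed `n`-torsion of `E`, `E'` over `K̄_E`
fixed by `Γ` (`hfixW`, `hfixW'`), the `Γ`-fixed `n`-torsion of `E(K̄_E)` of rank one (`hcyc`). Let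
`φ : Γ_K → E'[n]` be a continuous crossed homomorphism dying in `H¹(Γ, E'(K̄_E))` through `a'`
(`φ(σ) = σa' − a'`, i.e. `[φ] ∈ 𝓢_E(E')`), `n • a' = n • Q'` with `Q'` fixed by `H`, and `Q₁ ∈ E(K̄_E)`
fixed by `H` with `n • Q₁` fixed by `Γ` and `F • Q₁ ≠ Q₁`. **Then `θ_*[φ] ∈ 𝓢_E(E)`.** (FILE 1's
criterion (d) is the case `a'` = a root of a global point; same computation: `t := a' − Q'` is
`n`-torsion, `φ(σ) = (σQ' − Q') + (σt − t)`, and `θ(σQ' − Q') = m • (σQ₁ − Q₁)`.)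
Silverman *AEC* VIII.§2, X.§4; Cremona–Mazur 2000 §3. [folklore] -/
theorem h1Equiv_oneCocycleClass_mem_selmerLocalKer_of_twistedCocycle (hn : n ≠ 0)
    (φ : contOneCocycles (discreteTopRep (absoluteGaloisGroup K) (geomTorsion W' n)))
    (a' : localPoints W' E)
    (ha' : ∀ σ : absoluteGaloisGroup E,
      pointsMap W' E ((φ.1 (resGal (K := K) E σ) : geomTorsion W' n) : geomPoints W') = σ • a' - a')
    (H : Subgroup (absoluteGaloisGroup E)) (hH : H.Normal) (F : absoluteGaloisGroup E)
    (hgen : ∀ σ : absoluteGaloisGroup E, ∃ (i : ℕ) (h : absoluteGaloisGroup E), h ∈ H ∧ σ = F ^ i * h)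
    (hfixW : ∀ T : localPoints W E, n • T = 0 → (∀ h ∈ H, h • T = T) →
      ∀ σ : absoluteGaloisGroup E, σ • T = T)
    (hfixW' : ∀ T : localPoints W' E, n • T = 0 → (∀ h ∈ H, h • T = T) →
      ∀ σ : absoluteGaloisGroup E, σ • T = T)
    (hcyc : ∀ T₁ T₂ : localPoints W E, n • T₁ = 0 → n • T₂ = 0 →
      (∀ σ : absoluteGaloisGroup E, σ • T₁ = T₁) → (∀ σ : absoluteGaloisGroup E, σ • T₂ = T₂) →
      T₁ ≠ 0 → ∃ m : ℤ, T₂ = m • T₁)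
    (Q' : localPoints W' E) (hQ'H : ∀ h ∈ H, h • Q' = Q') (hQ' : n • Q' = n • a')
    (Q₁ : localPoints W E) (hQ₁H : ∀ h ∈ H, h • Q₁ = Q₁)
    (hQ₁ : n • Q₁ ∈ MulAction.fixedPoints (absoluteGaloisGroup E) (localPoints W E))
    (hQ₁F : F • Q₁ ≠ Q₁) :
    h1Equiv θ hθ (oneCocycleClass _ φ) ∈ selmerLocalKer W E n := by
  rw [h1Equiv_oneCocycleClass, selmerLocalKer, oneCocycleClass_mem_resKer_iff]
  set ιθ : AddSubgroup.torsionBy (localPoints W' E) n →+ localPoints W E :=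
    (pointsMap W E).comp ((geomTorsion W n).subtype.comp
      (θ.toAddMonoidHom.comp (W'.torsionPointsEquiv n (E := E) hn).symm.toAddMonoidHom)) with hιθ
  have hιθ_apply : ∀ T', ιθ T' =
      pointsMap W E (θ ((W'.torsionPointsEquiv n (E := E) hn).symm T') : geomTorsion W n) :=
    fun T' ↦ rfl
  have hιθ_smul : ∀ (σ : absoluteGaloisGroup E) T', ιθ (σ • T') = σ • ιθ T' := fun σ T' ↦ by
    rw [hιθ_apply, hιθ_apply, localTransport_smul W W' hn θ E hθ σ T']
  have hafix : ∀ σ : absoluteGaloisGroup E, σ • (n • a') = n • a' := by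
    intro σ
    have h0 : n • (σ • a' - a') = 0 := by
      rw [← ha' σ, ← map_zsmul, (mem_geomTorsion_iff W' _ _).mp (φ.1 _).2, map_zero]
    rw [W'.smul_zsmul_localPoints n σ a']
    rw [zsmul_sub, sub_eq_zero] at h0
    exact h0
  have hQ'fix : n • Q' ∈ MulAction.fixedPoints (absoluteGaloisGroup E) (localPoints W' E) :=
    fun σ ↦ by rw [hQ', hafix σ]
  set τ' : localPoints W' E := a' - Q' with hτ'def
  have hτ' : τ' ∈ AddSubgroup.torsionBy (localPoints W' E) n := by
    change n • τ' = 0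
    rw [hτ'def, zsmul_sub, hQ', sub_self]
  have hd'tors : ∀ σ : absoluteGaloisGroup E, n • (σ • Q' - Q') = 0 := fun σ ↦
    smul_sub_mem_torsionBy_localPoints hQ'fix σ
  have hd'fix : ∀ σ τ : absoluteGaloisGroup E, σ • (τ • Q' - Q') = τ • Q' - Q' := fun σ τ ↦
    hfixW' _ (hd'tors τ) (fun h hh ↦ smul_sub_eq_of_normal hH Q' hQ'H τ hh) σ
  have hd₁tors : ∀ σ : absoluteGaloisGroup E, n • (σ • Q₁ - Q₁) = 0 := fun σ ↦
    smul_sub_mem_torsionBy_localPoints hQ₁ σ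
  have hd₁fix : ∀ σ τ : absoluteGaloisGroup E, σ • (τ • Q₁ - Q₁) = τ • Q₁ - Q₁ := fun σ τ ↦
    hfixW _ (hd₁tors τ) (fun h hh ↦ smul_sub_eq_of_normal hH Q₁ hQ₁H τ hh) σ
  set D' : AddSubgroup.torsionBy (localPoints W' E) n := ⟨F • Q' - Q', hd'tors F⟩ with hD'def
  have hD'fix : ∀ σ : absoluteGaloisGroup E, σ • D' = D' := fun σ ↦
    Subtype.ext (by
      rw [Literature.NumberTheory.EllipticCurves.AddSubgroup.torsionBy.coe_smul]; exact hd'fix σ F)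
  have hyfix : ∀ σ : absoluteGaloisGroup E, σ • ιθ D' = ιθ D' := fun σ ↦ by
    rw [← hιθ_smul, hD'fix σ]
  have hytors : n • ιθ D' = 0 := by
    rw [← map_zsmul]
    have : n • D' = 0 := Subtype.ext (by
      rw [AddSubgroupClass.coe_zsmul]; exact hd'tors F)
    rw [this, map_zero]
  have hx0 : F • Q₁ - Q₁ ≠ 0 := fun h0 ↦ hQ₁F (sub_eq_zero.mp h0)
  obtain ⟨m, hm⟩ := hcyc (F • Q₁ - Q₁) (ιθ D') (hd₁tors F) hytors (fun σ ↦ hd₁fix σ F) hyfix hx0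
  refine ⟨m • Q₁ + ιθ ⟨τ', hτ'⟩, fun σ ↦ ?_⟩
  obtain ⟨i, h, hh, rfl⟩ := hgen σ
  set x : geomTorsion W' n := φ.1 (resGal (K := K) E (F ^ i * h)) with hxdef
  have hxval : pointsMap W' E (x : geomPoints W') = (F ^ i * h) • a' - a' := ha' (F ^ i * h)
  have hxmem : pointsMap W' E (x : geomPoints W') ∈ AddSubgroup.torsionBy (localPoints W' E) n := by
    change n • pointsMap W' E (x : geomPoints W') = 0
    rw [← map_zsmul, (mem_geomTorsion_iff W' n _).mp x.2, map_zero]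
  change pointsMap W E ((θ x : geomTorsion W n) : geomPoints W) = _
  rw [← localTransport_apply_pointsMap W W' hn θ E x hxmem, ← hιθ_apply]
  -- `σa' − a' = (σQ' − Q') + (στ' − τ') = i • D' + ∂τ'(σ)`
  have hdecomp : (⟨pointsMap W' E (x : geomPoints W'), hxmem⟩ :
      AddSubgroup.torsionBy (localPoints W' E) n) =
        (i : ℤ) • D' + ((F ^ i * h) • (⟨τ', hτ'⟩ : AddSubgroup.torsionBy (localPoints W' E) n) -
          ⟨τ', hτ'⟩) := by
    apply Subtype.ext
    rw [AddSubgroup.coe_add, AddSubgroup.coe_sub, AddSubgroupClass.coe_zsmul,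
      Literature.NumberTheory.EllipticCurves.AddSubgroup.torsionBy.coe_smul]
    change pointsMap W' E (x : geomPoints W') = (i : ℤ) • (F • Q' - Q') + ((F ^ i * h) • τ' - τ')
    rw [hxval, ← pow_mul_smul_sub_eq_zsmul Q' F hd'fix (hQ'H h hh) i, hτ'def, smul_sub]
    abel
  have hQ₁val : (F ^ i * h) • Q₁ = (i : ℤ) • (F • Q₁ - Q₁) + Q₁ := by
    rw [← pow_mul_smul_sub_eq_zsmul Q₁ F hd₁fix (hQ₁H h hh) i, sub_add_cancel]
  rw [hdecomp, map_add, map_sub, map_zsmul, hιθ_smul, hm, smul_add,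
    W.smul_zsmul_localPoints m (F ^ i * h) Q₁, hQ₁val]
  generalize (F ^ i * h) • ιθ ⟨τ', hτ'⟩ = b
  generalize ιθ ⟨τ', hτ'⟩ = a
  generalize F • Q₁ = q
  module

end Criterion

end Summit.BirchSwinnertonDyer.Rank1Residual.GaloisImage.TwistedWitness

end
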